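import Literature.AlgebraicGeometry.Frobenioids.ArchimedeanUnitGroupsAngular
import Literature.AlgebraicGeometry.Frobenioids.PreFrobenioidDataOfFunctor
import Literature.AlgebraicGeometry.Frobenioids.ArchimedeanMorphismTypes
import Mathlib.NumberTheory.Real.Irrational
import Mathlib.Analysis.SpecialFunctions.Complex.Circle
import HarnessLib

/-!
# Frobenioids II, Theorem 3.6 (ii): "the complex isotropic objects of `A` are Frobenius-compact"
# (abc-iut cell, layer L1, node `FrdII:Thm3.6(ii)`, L1-lead row M16 piece 2; proof-only companion of
# `ArchimedeanStandardType.lean` / `ArchimedeanBasicProperties.lean`, seat abc-iut-L1-t9)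

Mochizuki, *The geometry of Frobenioids II: poly-Frobenioids*, Kyushu J. Math. **62** (2008)
401–460, §3, Theorem 3.6 (ii), proof p. 38 ll. 33–35 [cite: MochizukiFrdII2008, Thm 3.6 (ii) p.37]:

> "If, moreover, `D` is of FSMFF- and RC-iso-subanchor type [which implies, in particular, that `D`
> admits complex objects], then one verifies immediately that the complex isotropic objects of `A` are
> Frobenius-compact".

Frobenius-compact ([FrdI] Def. 1.2 (iv), typed as `PreFrobenioidData.IsFrobeniusCompact`): `O^×(X)` is
commutative, has an element of infinite order ("`O^×(X)^pf ≠ 0`"), and every automorphism of `X` whose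
conjugation action on `O^×(X)^pf` is multiplication by a positive rational number acts trivially on
`O^×(X)^pf`.  PROVED here (nothing defined), for the angular Frobenioid `A` over ANY base `π : D → D₀`
and an object `X` whose `C₀`-component is complex with isotropic angular region:
* `Circle.exists_not_isOfFinOrder'`: the circle group has an element of infinite order (the image of
  `√2` under `ℝ/ℤ → S¹`);
* in `C = C₀ ×_{D₀} D`, conjugation by an automorphism `f` of `X` acts on a unit `u = ((id, 1, c), id)`
  through the Galois twist of the base of `f`: `f u f⁻¹ = u` if `f` lies over the identity of `Spec ℂ`,
  `f u f⁻¹ = u⁻¹` if it lies over complex conjugation (`C.scalar_conj_fst`, `C.conj_unit_eq`);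
* `A.isFrobeniusCompact_of_isComplex_isotropic`: `O^×_A(X) ≅ O^×_C(X) ≅ S¹` (abc-iut-L1-t9 / L6-d7:
  `A.nonempty_unitsSubgroup`, `circleEquivUnits`) is commutative with an element of infinite order; an
  automorphism over the identity acts trivially; an automorphism over complex conjugation inverts every
  unit, so it cannot act by a positive rational power on a unit of infinite order — the hypothesis of the
  third condition is never met;
* `exists_complex_of_isOfRCIsoSubanchorType`: "[RC-iso-subanchor type implies that `D` admits complex
  objects]" — given ANY object of `D` (print excludes `D = ∅` by the standing hypothesis "`D` connected",
  Ex. 3.3 (i) p. 27); hence `A.exists_isotropic_isFrobeniusCompact`: over a base of RC-iso-subanchor type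
  with an object, `A` has an isotropic Frobenius-compact object — the input `hfc` of
  `ArchFrd.A.isOfStandardType_of` (`ArchimedeanStandardTypeProofs.lean`).
No statement of the paper is strengthened; no side is taken on [IUTchIII] Cor. 3.12.
-/

namespace Literature.AlgebraicGeometry.Frobenioids

open CategoryTheory

universe v u

/-! ### An element of infinite order on the circle -/

/-- The circle group `S¹ ⊆ ℂ^×` has an element of infinite order: the image of `√2 ∈ ℝ/ℤ` (a point of
`ℝ/ℤ` has finite order iff it is rational). [cite: MochizukiFrdI2008, Def. 1.2 (iv) p.23] -/
theorem Circle.exists_not_isOfFinOrder' : ∃ z : Circle, ¬ IsOfFinOrder z := by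
  haveI : Fact ((0 : ℝ) < 1) := ⟨one_pos⟩
  refine ⟨AddCircle.toCircle ((Real.sqrt 2 : ℝ) : AddCircle (1 : ℝ)), fun h => ?_⟩
  obtain ⟨n, hn, hz⟩ := isOfFinOrder_iff_pow_eq_one.mp h
  rw [← AddCircle.toCircle_nsmul, ← AddCircle.toCircle_zero] at hz
  have hz' := AddCircle.injective_toCircle one_ne_zero hz
  have hfin : IsOfFinAddOrder ((Real.sqrt 2 : ℝ) : AddCircle (1 : ℝ)) :=
    isOfFinAddOrder_iff_nsmul_eq_zero.mpr ⟨n, hn, hz'⟩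
  refine (AddCircle.not_isOfFinAddOrder_iff_forall_rat_ne_div (p := (1 : ℝ))
    (a := Real.sqrt 2)).mpr (fun q => ?_) hfin
  rw [div_one]
  exact (irrational_sqrt_two.ne_rat q).symm

namespace ArchFrd

variable {D : Type u} [Category.{v} D] (π : D ⥤ D0)

/-! ### Conjugating a unit of `C` by an automorphism -/

/-- A conjugate `f u f⁻¹` of a unit `u ∈ O^×(X)` of `C` by an automorphism `f` of `X` is a unit.
[cite: MochizukiFrdII2008, Thm 3.6 (v) p.37] -/
theorem C.conj_mem_unitsSubgroup (X : C π) (f u : Aut X)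
    (hu : u ∈ PreFrobenioid.unitsSubgroup (C.toElem π) X) :
    f * u * f⁻¹ ∈ PreFrobenioid.unitsSubgroup (C.toElem π) X := by
  haveI : IsIso f.hom.fst := CFP.isIso_fst f.hom
  haveI : IsIso f.inv.fst := CFP.isIso_fst f.inv
  have hdf : C0.degFr f.hom.fst = 1 := (C0.of_isIso f.hom.fst).2.1
  have hdi : C0.degFr f.inv.fst = 1 := (C0.of_isIso f.inv.fst).2.1
  have hsu : u.hom.snd = 𝟙 X.snd := hu.1
  have hdu : C0.degFr u.hom.fst = 1 := hu.2
  refine ⟨?_, ?_⟩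
  · change (f.inv ≫ u.hom ≫ f.hom).snd = 𝟙 X.snd
    rw [CFP.comp_snd, CFP.comp_snd, hsu, Category.id_comp, ← CFP.comp_snd, f.inv_hom_id]
    rfl
  · change C0.degFr (f.inv ≫ u.hom ≫ f.hom).fst = 1
    rw [CFP.comp_fst, CFP.comp_fst, C0.degFr_comp', C0.degFr_comp', hdi, hdu, hdf, mul_one, mul_one]

/-- **The conjugation formula**: for a unit `u = ((id, 1, c), id)` of `X ∈ Ob(C)` and an automorphism
`f` of `X`, the scalar of `f u f⁻¹` is the Galois twist of `c` along the base of `f`: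
`scalar(f u f⁻¹) = ι(c)`, `ι ∈ {id, conj}` the twist of `Base(f⁻¹) = Base(f)`.
[cite: MochizukiFrdII2008, Thm 3.6 (iv) p.37] -/
theorem C.scalar_conj_fst (X : C π) (f u : Aut X)
    (hu : u ∈ PreFrobenioid.unitsSubgroup (C.toElem π) X) :
    C0.scalar (f * u * f⁻¹).hom.fst = (C0.Base f.inv.fst).act (C0.scalar u.hom.fst) := by
  haveI : IsIso f.hom.fst := CFP.isIso_fst f.hom
  have hdf : C0.degFr f.hom.fst = 1 := (C0.of_isIso f.hom.fst).2.1
  have hbu : C0.Base u.hom.fst = 𝟙 _ := UnitStab.base_fst_eq_id π X u hu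
  have hdu : C0.degFr u.hom.fst = 1 := hu.2
  -- `ι(c_f) · c_{f⁻¹} = 1` from `f⁻¹ ≫ f = id`
  have hrel : (C0.Base f.inv.fst).act (C0.scalar f.hom.fst) * C0.scalar f.inv.fst = 1 := by
    have h := congrArg (fun g => C0.scalar (CFP.Hom.fst g)) f.inv_hom_id
    change C0.scalar (f.inv.fst ≫ f.hom.fst) = C0.scalar (𝟙 X.fst) at h
    rw [C0.scalar_comp', C0.scalar_id', hdf, PNat.one_coe, pow_one] at h
    exact h
  change C0.scalar (f.inv.fst ≫ u.hom.fst ≫ f.hom.fst) = _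
  rw [C0.scalar_comp', C0.scalar_comp', C0.degFr_comp', hbu, hdu, hdf, one_mul, PNat.one_coe,
    pow_one, pow_one]
  unfold D0.Hom.act at hrel ⊢
  rw [D0.twists_id, D0.galAct_false, map_mul, mul_right_comm, hrel, one_mul]

/-- **Conjugation acts on `O^×(X) ≅ S¹` through `Gal(ℂ/ℝ)`**: for `X ∈ Ob(C)`, a unit `u ∈ O^×(X)`
and an automorphism `f` of `X`: if `f` lies over the identity of `D₀` then `f u f⁻¹ = u`; if `f` lies
over complex conjugation then `f u f⁻¹ = u⁻¹` (the scalar of a unit has absolute value `1`, and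
`conj(c) = c⁻¹` on `S¹`). [cite: MochizukiFrdII2008, Thm 3.6 (iv) p.37] -/
theorem C.conj_unit_eq (X : C π) (f u : Aut X) (hu : u ∈ PreFrobenioid.unitsSubgroup (C.toElem π) X) :
    (D0.Hom.twists (C0.Base f.inv.fst) = false → f * u * f⁻¹ = u) ∧
      (D0.Hom.twists (C0.Base f.inv.fst) = true → f * u * f⁻¹ = u⁻¹) := by
  have hmem := C.conj_mem_unitsSubgroup π X f u hu
  have hsc := C.scalar_conj_fst π X f u hu
  refine ⟨fun ht => ?_, fun ht => ?_⟩
  · apply UnitStab.eq_of_scalar_eq π X _ _ hmem hu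
    rw [hsc]
    unfold D0.Hom.act
    rw [ht, D0.galAct_false]
  · apply UnitStab.eq_of_scalar_eq π X _ _ hmem (inv_mem hu)
    rw [hsc]
    unfold D0.Hom.act
    rw [ht, D0.galAct_true]
    change star (C0.scalar u.hom.fst) = C0.scalar u.inv.fst
    rw [UnitStab.scalar_inv_eq π X u hu]
    have hn := UnitStab.norm_scalar_eq_one π X u hu
    exact Units.ext (by
      rw [Units.coe_star, Units.val_inv_eq_inv_val, Complex.inv_eq_conj hn, starRingEnd_apply])

/-! ### The complex isotropic objects of `A` are Frobenius-compact -/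

/-- **Thm. 3.6 (ii), proof: "the complex isotropic objects of `A` are Frobenius-compact"** ([FrdI]
Def. 1.2 (iv) through the adapter `PreFrobenioidData.ofFunctor`): for `X ∈ Ob(A)` whose
`C₀`-component is complex with isotropic angular region, `O^×(X)` is commutative (it is `≅ S¹`), has
an element of infinite order, and an automorphism of `X` acting on `O^×(X)^pf` by a positive rational
power acts trivially (over the identity of `Spec ℂ` it fixes every unit; over complex conjugation it
inverts every unit, which is not a positive rational power on an element of infinite order).
[cite: MochizukiFrdII2008, Thm 3.6 (ii) p.37] -/
theorem A.isFrobeniusCompact_of_isComplex_isotropic (X : A π) (hX : X.obj.fst.IsNaivelyIsotropic)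
    (hc : X.obj.fst.IsComplexObj) :
    (PreFrobenioidData.ofFunctor (zeroMonoid D : Dᵒᵖ ⥤ CommMonCat.{0})
      (A.toElem π)).IsFrobeniusCompact X := by
  obtain ⟨eAC⟩ := A.nonempty_unitsEquiv π X
  let e : PreFrobenioid.unitsSubgroup (A.toElem π) X ≃* Circle :=
    eAC.trans (circleEquivUnits π X.obj hX hc).symm
  -- transport of powers along `e`
  have hpow : ∀ (w : PreFrobenioid.unitsSubgroup (A.toElem π) X) (N : ℕ),
      (w : Aut X) ^ N = 1 → (e w) ^ N = 1 := by
    intro w N h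
    have h1 : w ^ N = 1 := Subtype.ext (by simpa using h)
    have h2 := congrArg e h1
    rwa [map_pow, map_one] at h2
  -- the inclusion `A ⊆ C` on automorphism groups
  let ι : Aut X →* Aut X.obj := (A.ι π).mapAut X
  have hι : Function.Injective ι := fun a b h =>
    (A.ι π).mapIso_injective (X := X) (Y := X) h
  have hιmem : ∀ w : Aut X,
      w ∈ (PreFrobenioidData.ofFunctor (zeroMonoid D : Dᵒᵖ ⥤ CommMonCat.{0})
        (A.toElem π)).unitsSubgroup X →
      ι w ∈ PreFrobenioid.unitsSubgroup (C.toElem π) X.obj := fun w hw => ⟨hw.1, hw.2⟩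
  obtain ⟨z, hz⟩ := Circle.exists_not_isOfFinOrder'
  refine ⟨fun u hu u' hu' => ?_, ⟨(e.symm z : Aut X), (e.symm z).2, fun N hN hN1 => hz ?_⟩,
    fun f p q H u hu => ?_⟩
  · -- commutative: `O^×(X) ≅ S¹`
    have h := e.injective (show e (⟨u, hu⟩ * ⟨u', hu'⟩) = e (⟨u', hu'⟩ * ⟨u, hu⟩) by
      rw [map_mul, map_mul, mul_comm])
    exact congrArg Subtype.val h
  · -- an element of infinite order
    have h2 := hpow (e.symm z) N hN1
    rw [MulEquiv.apply_symm_apply] at h2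
    exact isOfFinOrder_iff_pow_eq_one.mpr ⟨N, hN, h2⟩
  · -- automorphisms acting by a positive rational power act trivially
    have key := C.conj_unit_eq π X.obj (ι f)
    cases ht : D0.Hom.twists (C0.Base (ι f).inv.fst) with
    | false =>
      refine ⟨1, one_pos, ?_⟩
      rw [pow_one, pow_one]
      apply hι
      rw [map_mul, map_mul, map_inv]
      exact ((key (ι u) (hιmem u hu)).1 ht)
    | true =>
      exfalso
      have hu₀ := (e.symm z).2
      obtain ⟨N, hN, hEq⟩ := H (e.symm z : Aut X) hu₀
      have hA : f * (e.symm z : Aut X) * f⁻¹ = (e.symm z : Aut X)⁻¹ := by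
        apply hι
        rw [map_mul, map_mul, map_inv, map_inv]
        exact (key (ι (e.symm z : Aut X)) (hιmem _ hu₀)).2 ht
      rw [hA, ← pow_mul, ← pow_mul, inv_pow] at hEq
      have h3 := inv_eq_iff_mul_eq_one.mp hEq
      rw [← pow_add] at h3
      have h4 := hpow (e.symm z) _ h3
      rw [MulEquiv.apply_symm_apply] at h4
      exact hz (isOfFinOrder_iff_pow_eq_one.mpr ⟨_, Nat.add_pos_left (Nat.mul_pos q.pos hN) _, h4⟩)

/-! ### "[RC-iso-subanchor type implies that `D` admits complex objects]" -/

/-- Over a base `D → D₀` of RC-iso-subanchor type, every object of `D` leads to a COMPLEX object of `D`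
(an RC-iso-subanchor receives an arrow from an RC-subanchor, which maps to an RC-anchor, which is
complex by definition) — "[which implies, in particular, that `D` admits complex objects]", FrdII p. 38
l. 33 (for nonempty `D`; print's `D` is connected, Ex. 3.3 (i) p. 27). [cite: MochizukiFrdII2008, Thm 3.6 (ii) p.37] -/
theorem exists_complex_of_isOfRCIsoSubanchorType (hrc : RC.IsOfRCIsoSubanchorType (baseRC π)) (d : D) :
    ∃ Z : D, (π.obj Z).IsComplex := by
  obtain ⟨B, -, -, ⟨Z, ⟨hZ, -⟩, -⟩, -⟩ := hrc.isRCIsoSubanchor d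
  exact ⟨Z, (D0.isComplex_toArchBase_iff _).mp hZ⟩

/-- **Thm. 3.6 (ii), clause (b) of "standard type" for `A`**: over a base of RC-iso-subanchor type
having an object, the angular Frobenioid `A` has an isotropic Frobenius-compact object — the unit-disc
object `((Spec ℂ, [full circle], tip 1), Z)` over a complex object `Z` of `D`. This is the input `hfc`
of `ArchFrd.A.isOfStandardType_of`. [cite: MochizukiFrdII2008, Thm 3.6 (ii) p.37] -/
theorem A.exists_isotropic_isFrobeniusCompact (hrc : RC.IsOfRCIsoSubanchorType (baseRC π)) (d : D) :
    ∃ X : A π,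
      (PreFrobenioidData.ofFunctor (zeroMonoid D : Dᵒᵖ ⥤ CommMonCat.{0}) (A.toElem π)).IsIsotropic X ∧
        (PreFrobenioidData.ofFunctor (zeroMonoid D : Dᵒᵖ ⥤ CommMonCat.{0})
          (A.toElem π)).IsFrobeniusCompact X := by
  obtain ⟨Z, hZ⟩ := exists_complex_of_isOfRCIsoSubanchorType π hrc d
  let X0 : C0 := ⟨D0.complex, AngularRegion.isotropicOfTip 1,
    fun _ => AngularRegion.isIsotropic_isotropicOfTip 1⟩
  have hZ' : X0.base = π.obj Z := hZ.symm
  let Xc : C π := ⟨X0, Z, eqToIso hZ'⟩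
  let X : A π := ⟨Xc⟩
  have hX : X.obj.fst.IsNaivelyIsotropic := AngularRegion.isIsotropic_isotropicOfTip 1
  have hc : X.obj.fst.IsComplexObj := rfl
  refine ⟨X, ?_, A.isFrobeniusCompact_of_isComplex_isotropic π X hX hc⟩
  exact (PreFrobenioidData.ofFunctor_isIsotropic _ X).mpr
    ((Ex33iii_isotropic_iff_holds π X).mpr ((Ex33ii_isotropic_iff_holds π X.obj).mpr hX))

end ArchFrd

end Literature.AlgebraicGeometry.Frobenioids
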